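import Summits.NavierStokesRegularity.NavierStokesRegularity.Theorems.ScenarioCensusRowF19Top
import Summits.NavierStokesRegularity.FluidComputer.PalasekTowerLineCrossing
import Literature.Analysis.FluidPDE.NSVorticityBKMContinuation
import HarnessLib

/-!
# Census row F19 family, peak members «peak push» (G-peak / IG-peak / F1peak) — part 1/4: speed peaks, the criteria,
# the rows P-peak / G-peak / G-lab / F1peak, the structural statement `PeakPushFloor`, the residual; the curved moving level;
# the first-crossing lemma `exists_peak_hit`

Re-homed for the scenario census (typer seat ns-census-typer-1 g6; lead g8 GO 2026-08-28T18:54Z, OPTIONAL (3) «F19 peak members»: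
PORT of ns-idea-3 LINE 13 «peak-push» REV 3, `pub/ideators/ns-idea-3/lines/peak-push/line-peak-push.rev3.lean`, sha16
191fe95c2723e21c, 991 l., §1–§7 — REV 4 = REV 3 + §8 «pressure-force rows», NOT ported now; lean check rc 0, 0 sorry; ref g7
PRE-CHECK ✓ §12.31; critic idea-crit-3 RE-STAMPs 17:19:45Z / 17:22:09Z; lead g7 BOOKINGS 17:28Z: MEMBERS OF RECORD of the F19
family row = G-peak, IG-peak, F1peak — TREE records under ROW POLICY 15:11Z / cen9 (2), no new row, no value change), split for
the 400-line rule into `ScenarioCensusRowF19peakTop` (§1–§3: speed peaks, criteria, rows, the curved moving level, the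
first-crossing lemma) → `ScenarioCensusRowF19peakFloor` (§4–§5: the peak-push floor from row F1a BY NAME, rows P/G/G-lab/F1peak,
residual) → `ScenarioCensusRowF19peakDoor` (§6: the integral door, rows I/IG/PG-peak) → `ScenarioCensusRowF19peak` (§7: the
lattice on classical solutions; census keys).  Lean text VERBATIM in namespace `…Theorems.ScenarioCensus.PeakPush` (the line's
`…Cruxes.ScenarioCensusRowF1.PeakPushLine` re-homed); the three real-variable tools identical to LINE 11's (`deltaStar_pos`,
`kappa_mul_lt_one`, `hasDerivAt_inv_sqrt_sub`) are taken from the tree's F19 port (`ScenarioCensus.QuasiSteadyTop`,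
`ScenarioCensusRowF19Top.lean`) instead of being restated; one bib key corrected (`Tao2013Localisation`); the `[folklore]`
tags of the parameterless row `def`s dropped (gate relocation rule); one-line docstrings added to six undocumented auxiliaries.

The instrument is the SPEED ARGMAX: `IsSpeedPeak u t x` (a global spatial argmax of `|u(t,·)|`); the criteria are read there only
— P-peak `HasSubcriticalPeakPush` (`−⟪u,∇p⟫ ≤ ν|Du|²_F + δ√ν(T−t)^{-3/2}|u|` at the fast speed peaks near `T`), G-peak
`HasSubcriticalPeakGain` (`⟪u,∂ₜu⟫ ≤ δ√ν(T−t)^{-3/2}|u|` there), `0 ≤ δ < 9 − 2√15`; the mechanism is a FIRST CROSSING of the curved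
moving speed level `movingLevel K δc T t₁` at a global argmax (tree `HittingCalculus`, Palasek-tower Clay bridge, Tao cover
`RungReynoldsOne.stub_taoCover`, `LocalEnergy.exists_radius_norm_lt`) + census row F1a BY NAME (part 2).

No census value is asserted here (the lead books the F19 family); NS regularity is NOT proved; `Row_F1` stays open
(≡ `TypeIPeakModeration`); no summit statement is proved by this file.
-/

noncomputable section

set_option linter.dupNamespace false

open MeasureTheory Set Function Filter TopologicalSpace Metric
open scoped Topology NNReal ENNReal Laplacian RealInnerProductSpace

namespace Summit.NavierStokesRegularity.NavierStokesRegularity.Theorems.ScenarioCensus.PeakPush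

open Literature.Analysis Literature.Analysis.FluidPDE
open Summit.NavierStokesRegularity.NavierStokesRegularity.Theorems
open Summit.NavierStokesRegularity.FluidComputer.PalasekTowerClayBridge

/-- `ℝ³`. -/
abbrev E3 := EuclideanSpace ℝ (Fin 3)

/-! ## §1 Speed peaks, the criteria, the rows -/

/-- `x` is a **speed peak** of `u` at time `t`: a global spatial argmax of `|u(t,·)|`. [folklore] -/
def IsSpeedPeak (u : ℝ → E3 → E3) (t : ℝ) (x : E3) : Prop := ∀ y, ‖u t y‖ ≤ ‖u t x‖

/-- **Subcritically pushed peaks, modulus `δ`**: at every fast speed peak `(t,x)` (`Λ < |u(t,x)|`), `t`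
near `T`, the pressure push on the fastest particle, net of the local dissipation, is `δ`-subcritical for
the blow-up clock: `−⟪u, ∇p⟫ ≤ ν|Du|²_F + δ√ν/((T−t)√(T−t)) · |u|`. [folklore] -/
def HasSubcriticalPeakPush (ν T δ : ℝ) (u : ℝ → E3 → E3) (p : ℝ → E3 → ℝ) : Prop :=
  ∃ Λ : ℝ, ∀ᶠ t in 𝓝[<] T, ∀ x, IsSpeedPeak u t x → Λ < ‖u t x‖ →
    -⟪u t x, gradient (p t) x⟫ ≤
      ν * frobeniusNormSq (fderiv ℝ (u t) x) + δ * Real.sqrt ν / ((T - t) * Real.sqrt (T - t)) * ‖u t x‖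

/-- **Subcritical peak gain, modulus `δ`**: at every fast speed peak, `t` near `T`, the speed of the
fastest particle gains at most `δ`-subcritically: `⟪u, ∂ₜu⟫ ≤ δ√ν/((T−t)√(T−t)) · |u|`. [folklore] -/
def HasSubcriticalPeakGain (ν T δ : ℝ) (u : ℝ → E3 → E3) : Prop :=
  ∃ Λ : ℝ, ∀ᶠ t in 𝓝[<] T, ∀ x, IsSpeedPeak u t x → Λ < ‖u t x‖ →
    ⟪u t x, timeDerivWithin (Ico 0 T) u t x⟫ ≤
      δ * Real.sqrt ν / ((T - t) * Real.sqrt (T - t)) * ‖u t x‖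

/-- **Row P-peak** (no rate · no symmetry · Clay class): subcritically pushed peaks with modulus
`0 ≤ δ < 9 − 2√15` ⇒ smooth extension past `T`.  PROVED (`rowPpeak_holds`). -/
def Row_Ppeak : Prop :=
  ∀ (ν T δ : ℝ), 0 < ν → 0 < T → 0 ≤ δ → δ < 9 - 2 * Real.sqrt 15 →
    ∀ (u : ℝ → E3 → E3) (p : ℝ → E3 → ℝ),
    IsClassicalNSSolutionOn (Ico 0 T) ν 0 u p → IsLerayHopfOn T ν 0 (u 0) u →
    HasRapidSpatialDecay (u 0) → HasSubcriticalPeakPush ν T δ u p → HasSmoothExtensionPast ν 0 u T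

/-- **Row G-peak** (no rate · no symmetry · Clay class): subcritical peak gain with modulus
`0 ≤ δ < 9 − 2√15` ⇒ smooth extension past `T`.  PROVED (`rowGpeak_holds`). -/
def Row_Gpeak : Prop :=
  ∀ (ν T δ : ℝ), 0 < ν → 0 < T → 0 ≤ δ → δ < 9 - 2 * Real.sqrt 15 →
    ∀ (u : ℝ → E3 → E3) (p : ℝ → E3 → ℝ),
    IsClassicalNSSolutionOn (Ico 0 T) ν 0 u p → IsLerayHopfOn T ν 0 (u 0) u →
    HasRapidSpatialDecay (u 0) → HasSubcriticalPeakGain ν T δ u → HasSmoothExtensionPast ν 0 u T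

/-- **Row G-lab** (the all-fast-points lab-gain row — LINE 12's `Row_Plab`, LINE 11's one-sided form —
restated verbatim in shape for the lattice edge `rowGlab_of_rowGpeak`): `⟪u, ∂ₜu⟫ ≤ δ√ν(T−t)^{-3/2}|u|`
at ALL fast points near `T` ⇒ extension.  PROVED (`rowGlab_holds`). -/
def Row_Glab : Prop :=
  ∀ (ν T δ : ℝ), 0 < ν → 0 < T → 0 ≤ δ → δ < 9 - 2 * Real.sqrt 15 →
    ∀ (u : ℝ → E3 → E3) (p : ℝ → E3 → ℝ),
    IsClassicalNSSolutionOn (Ico 0 T) ν 0 u p → IsLerayHopfOn T ν 0 (u 0) u →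
    HasRapidSpatialDecay (u 0) →
    (∃ Λ : ℝ, ∀ᶠ t in 𝓝[<] T, ∀ x, Λ < ‖u t x‖ →
      ⟪u t x, timeDerivWithin (Ico 0 T) u t x⟫ ≤
        δ * Real.sqrt ν / ((T - t) * Real.sqrt (T - t)) * ‖u t x‖) →
    HasSmoothExtensionPast ν 0 u T

/-- **Row F1peak** (Type-I member of row F1's split): Type-I Clay blow-up frame + subcritically pushed
peaks (`0 ≤ δ < 9 − 2√15`) ⇒ extension.  PROVED (`rowF1peak_holds`). -/
def Row_F1peak : Prop :=
  ∀ (ν T δ : ℝ), 0 < ν → 0 < T → 0 ≤ δ → δ < 9 - 2 * Real.sqrt 15 →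
    ∀ (u : ℝ → E3 → E3) (p : ℝ → E3 → ℝ),
    IsClassicalNSSolutionOn (Ico 0 T) ν 0 u p → IsLerayHopfOn T ν 0 (u 0) u →
    HasRapidSpatialDecay (u 0) → IsTypeIBlowup u T → HasSubcriticalPeakPush ν T δ u p →
    HasSmoothExtensionPast ν 0 u T

/-- **Structural statement «the peak-push floor»**: in every Clay blow-up (maximal, Leray–Hopf, decaying
datum; ANY rate), for every `0 ≤ δ < 9 − 2√15`, every level `Λ` and every `t₁ < T`, at some time
`t ∈ (t₁, T)` some GLOBAL SPEED PEAK `x` with `|u(t,x)| > Λ` has BOTH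
`ν|Du|²_F + δ√ν(T−t)^{-3/2}|u| < −⟪u, ∇p⟫` (the pressure alone pushes the fastest particle
supercritically, net of dissipation) and `δ√ν(T−t)^{-3/2}|u| < ⟪u, ∂ₜu⟫` (its speed gains
supercritically).  PROVED (`peakPushFloor_holds`). -/
def PeakPushFloor : Prop :=
  ∀ (ν T : ℝ), 0 < ν → 0 < T →
    ∀ (u : ℝ → E3 → E3) (p : ℝ → E3 → ℝ),
    IsMaximalSmoothSolution ν 0 u p T → IsLerayHopfOn T ν 0 (u 0) u → HasRapidSpatialDecay (u 0) →
    ∀ (δ Λ t₁ : ℝ), 0 ≤ δ → δ < 9 - 2 * Real.sqrt 15 → t₁ < T →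
      ∃ t ∈ Ioo t₁ T, ∃ x, IsSpeedPeak u t x ∧ Λ < ‖u t x‖ ∧
        ν * frobeniusNormSq (fderiv ℝ (u t) x) +
            δ * Real.sqrt ν / ((T - t) * Real.sqrt (T - t)) * ‖u t x‖ < -⟪u t x, gradient (p t) x⟫ ∧
        δ * Real.sqrt ν / ((T - t) * Real.sqrt (T - t)) * ‖u t x‖ <
          ⟪u t x, timeDerivWithin (Ico 0 T) u t x⟫

/-- **Residual** (maximal frame): every Type-I Clay blow-up has subcritically pushed peaks with some
modulus `< 9 − 2√15`.  `TypeIPeakModeration ↔ Row_F1` (`typeIPeakModeration_iff_rowF1`); DECLARED ≡ row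
F1. -/
def TypeIPeakModeration : Prop :=
  ∀ (ν T : ℝ), 0 < ν → 0 < T →
    ∀ (u : ℝ → E3 → E3) (p : ℝ → E3 → ℝ),
    IsMaximalSmoothSolution ν 0 u p T → IsLerayHopfOn T ν 0 (u 0) u →
    HasRapidSpatialDecay (u 0) → IsTypeIBlowup u T →
    ∃ δ : ℝ, 0 ≤ δ ∧ δ < 9 - 2 * Real.sqrt 15 ∧ HasSubcriticalPeakPush ν T δ u p

/-! ## §2 Real-variable tools and the curved moving level -/

/-- **The curved moving level** `L(t) = K + 2δc((T − max t t₁)^{-1/2} − (T−t₁)^{-1/2})`: constant `K` up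
to `t₁`, then rising with slope `δc (T−t)^{-3/2}` — the blow-up clock. [folklore] -/
def movingLevel (K δc T t₁ : ℝ) (t : ℝ) : ℝ :=
  K + 2 * δc * ((Real.sqrt (T - max t t₁))⁻¹ - (Real.sqrt (T - t₁))⁻¹)

/-- Before `t₁` the moving level is the constant `K`. -/
theorem movingLevel_of_le {K δc T t₁ t : ℝ} (h : t ≤ t₁) : movingLevel K δc T t₁ t = K := by
  simp [movingLevel, max_eq_right h]

/-- Past `t₁` the moving level is `K + 2δc((√(T−t))⁻¹ − (√(T−t₁))⁻¹)`. -/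
theorem movingLevel_of_ge {K δc T t₁ t : ℝ} (h : t₁ ≤ t) :
    movingLevel K δc T t₁ t = K + 2 * δc * ((Real.sqrt (T - t))⁻¹ - (Real.sqrt (T - t₁))⁻¹) := by
  simp [movingLevel, max_eq_left h]

/-- `K ≤ L(t)` for `t < T` (`δc ≥ 0`). [folklore] -/
theorem le_movingLevel {K δc T t₁ t : ℝ} (hδc : 0 ≤ δc) (ht : t < T) :
    K ≤ movingLevel K δc T t₁ t := by
  rcases le_or_gt t t₁ with h | h
  · rw [movingLevel_of_le h]
  · rw [movingLevel_of_ge h.le]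
    have hTt : 0 < T - t := sub_pos.2 ht
    have h1 : Real.sqrt (T - t) ≤ Real.sqrt (T - t₁) := Real.sqrt_le_sqrt (by linarith)
    have h2 : (Real.sqrt (T - t₁))⁻¹ ≤ (Real.sqrt (T - t))⁻¹ :=
      inv_anti₀ (Real.sqrt_pos.2 hTt) h1
    nlinarith

/-- `L` is continuous on `[0, t₂]` for `t₂ < T`. [folklore] -/
theorem continuousOn_movingLevel {K δc T t₁ t₂ : ℝ} (ht₁ : t₁ < T) (ht₂ : t₂ < T) :
    ContinuousOn (movingLevel K δc T t₁) (Icc 0 t₂) := by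
  have hc : ContinuousOn (fun t : ℝ => (Real.sqrt (T - max t t₁))⁻¹) (Icc 0 t₂) := by
    refine ContinuousOn.inv₀ ?_ fun t ht => ?_
    · exact (Real.continuous_sqrt.comp (continuous_const.sub (continuous_id.max continuous_const))).continuousOn
    · have : 0 < T - max t t₁ := by
        have : max t t₁ < T := max_lt (ht.2.trans_lt ht₂) ht₁
        linarith
      exact (Real.sqrt_pos.2 this).ne'
  unfold movingLevel
  exact continuousOn_const.add (continuousOn_const.mul (hc.sub continuousOn_const))

/-- Left (indeed two-sided) derivative of `L` at `t₀ ∈ (t₁, T)`: `L' = δc/((T−t₀)√(T−t₀))`. [folklore] -/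
theorem hasDerivWithinAt_movingLevel {K δc T t₁ t₀ : ℝ} (h₁ : t₁ < t₀) (h₀ : t₀ < T) :
    HasDerivWithinAt (movingLevel K δc T t₁) (δc / ((T - t₀) * Real.sqrt (T - t₀))) (Iic t₀) t₀ := by
  have hTt : 0 < T - t₀ := sub_pos.2 h₀
  have hden : 0 < (T - t₀) * Real.sqrt (T - t₀) := mul_pos hTt (Real.sqrt_pos.2 hTt)
  have h1 : HasDerivAt (fun t => K + 2 * δc * ((Real.sqrt (T - t))⁻¹ - (Real.sqrt (T - t₁))⁻¹))
      (0 + 2 * δc * (1 / (2 * ((T - t₀) * Real.sqrt (T - t₀))) - 0)) t₀ :=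
    (hasDerivAt_const t₀ K).add
      (((QuasiSteadyTop.hasDerivAt_inv_sqrt_sub h₀).sub (hasDerivAt_const t₀ _)).const_mul (2 * δc))
  have h2 : 0 + 2 * δc * (1 / (2 * ((T - t₀) * Real.sqrt (T - t₀))) - 0) =
      δc / ((T - t₀) * Real.sqrt (T - t₀)) := by
    field_simp
    ring
  rw [h2] at h1
  have heq : movingLevel K δc T t₁ =ᶠ[𝓝 t₀]
      fun t => K + 2 * δc * ((Real.sqrt (T - t))⁻¹ - (Real.sqrt (T - t₁))⁻¹) := by
    filter_upwards [Ioi_mem_nhds h₁] with t ht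
    exact movingLevel_of_ge (le_of_lt ht)
  exact (h1.congr_of_eventuallyEq heq).hasDerivWithinAt

/-! ## §3 The first-crossing lemma (tree `HittingCalculus` on a closed sub-slab) -/

variable {ν T : ℝ} {u : ℝ → E3 → E3} {p : ℝ → E3 → ℝ}

/-- The zero force is smooth on the closed half-space. [folklore] -/
theorem isSmoothOnHalfSpace_zero : IsSmoothOnHalfSpace (0 : ℝ → E3 → E3) := by
  have h : uncurry (0 : ℝ → E3 → E3) = fun _ => 0 := by
    funext q; rfl
  rw [IsSmoothOnHalfSpace, h]
  exact contDiffOn_const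

/-- The zero force has Fefferman's space-time decay. [folklore] -/
theorem hasRapidSpaceTimeDecay_zero : HasRapidSpaceTimeDecay (0 : ℝ → E3 → E3) := by
  intro n K
  have h : uncurry (0 : ℝ → E3 → E3) = 0 := by
    funext q; rfl
  refine ⟨0, fun t _ x => ?_⟩
  rw [h, iteratedFDerivWithin_zero]
  simp

/-- **First crossing of the curved moving level at a speed peak.**  Clay frame on `[0,T)`; `0 < t₁ < t₂ <
T`; `|u| < K` on `[0,t₁] × ℝ³`; the speed reaches `L(t₂)` somewhere at time `t₂`.  Then at some
`t⋆ ∈ (t₁, t₂]` and some speed peak `x⋆`: `|u(t⋆,x⋆)| = L(t⋆)`, the HITTING INEQUALITY WITH DRIFT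
`ν|Du|²_F + ⟪u,∇p⟫ + |u| L'(t⋆) ≤ 0` and the temporal first-order condition `|u| L'(t⋆) ≤ ⟪u, ∂ₜu⟫`,
`L'(t⋆) = δc/((T−t⋆)√(T−t⋆))`.  Ingredients BY NAME: the Tao cover (`RungReynoldsOne.stub_taoCover`) for
uniform bounds and uniform spatial decay on `[0,t₂]` (`LocalEnergy.exists_radius_norm_lt`), the tree's
`HittingCalculus.exists_firstHitting_movingLevel_of_decay`, `hitting_inequality_drift`,
`inner_timeDeriv_ge_of_past_le`. [cite: Tao2013Localisation, Cor. 11.1]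
[cite: GilbargTrudinger2001, §3.1] -/
theorem exists_peak_hit (hν : 0 < ν) (hT : 0 < T)
    (hsol : IsClassicalNSSolutionOn (Ico 0 T) ν 0 u p) (hLH : IsLerayHopfOn T ν 0 (u 0) u)
    (hdec : HasRapidSpatialDecay (u 0)) {K δc t₁ t₂ : ℝ} (hK : 0 < K) (hδc : 0 ≤ δc)
    (ht₁ : 0 < t₁) (ht₁₂ : t₁ < t₂) (ht₂ : t₂ < T)
    (hbefore : ∀ t ∈ Icc 0 t₁, ∀ x, ‖u t x‖ < K)
    (hreach : ∃ x, movingLevel K δc T t₁ t₂ ≤ ‖u t₂ x‖) :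
    ∃ t₀ ∈ Ioc t₁ t₂, ∃ x₀ : E3, IsSpeedPeak u t₀ x₀ ∧
      ‖u t₀ x₀‖ = movingLevel K δc T t₁ t₀ ∧
      ν * frobeniusNormSq (fderiv ℝ (u t₀) x₀) + ⟪u t₀ x₀, gradient (p t₀) x₀⟫ +
          ‖u t₀ x₀‖ * (δc / ((T - t₀) * Real.sqrt (T - t₀))) ≤ 0 ∧
      ‖u t₀ x₀‖ * (δc / ((T - t₀) * Real.sqrt (T - t₀))) ≤
        ⟪u t₀ x₀, timeDerivWithin (Ico 0 T) u t₀ x₀⟫ := by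
  have ht₂0 : 0 < t₂ := ht₁.trans ht₁₂
  have ht₁T : t₁ < T := ht₁₂.trans ht₂
  have hsolc : IsClassicalNSSolutionOn (Icc 0 t₂) ν 0 u p :=
    hsol.mono (Icc_subset_Ico_right ht₂) (uniqueDiffOn_Icc ht₂0)
  -- Tao class on the closed sub-slab: uniform bounds and uniform spatial decay
  obtain ⟨q, hsolq, hH, -, -⟩ := RungReynoldsOne.stub_taoCover hν hT hsol hLH hdec ⟨ht₂0, ht₂⟩
  obtain ⟨M, -, hM⟩ := exists_forall_norm_le_of_hasBoundedSobolevNormsOn hsolq hH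
  obtain ⟨B, -, hB⟩ := exists_forall_norm_fderiv_le_of_hasBoundedSobolevNormsOn
    (fun s hs => (hsolc.contDiff_velocity hs).of_le (by norm_cast)) hH
  have hE : ∃ C : ℝ≥0, ∀ t ∈ Icc 0 t₂, ∫⁻ x, ‖u t x‖ₑ ^ 2 ≤ C :=
    ⟨(2 * VectorCalculus.kineticEnergy (u 0)).toNNReal, fun t ht =>
      hLH.lintegral_enorm_sq_le hν.le ⟨ht.1, ht.2.trans ht₂.le⟩⟩
  obtain ⟨ρ, hρ⟩ := LocalEnergy.exists_radius_norm_lt hν ht₂0 hsolc isSmoothOnHalfSpace_zero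
    hasRapidSpaceTimeDecay_zero hM hB hE hK
  -- first hitting of the moving level
  have hLc : ContinuousOn (movingLevel K δc T t₁) (Icc 0 t₂) := continuousOn_movingLevel ht₁T ht₂
  have hbefore' : ∀ t ∈ Icc 0 t₁, ∀ x, ‖u t x‖ < movingLevel K δc T t₁ t := fun t ht x => by
    rw [movingLevel_of_le ht.2]; exact hbefore t ht x
  have hdecL : ∃ ρ : ℝ, ∀ t ∈ Icc 0 t₂, ∀ x : E3, ρ ≤ ‖x‖ → ‖u t x‖ < movingLevel K δc T t₁ t :=
    ⟨ρ, fun t ht x hx => (hρ t ht x hx).trans_le (le_movingLevel hδc (ht.2.trans_lt ht₂))⟩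
  obtain ⟨t₀, ht₀, x₀, heq, hmax, hpast⟩ :=
    HittingCalculus.exists_firstHitting_movingLevel_of_decay hsolc hLc ⟨ht₁.le, ht₁₂.le⟩ ht₁₂.le
      le_rfl hbefore' hreach hdecL
  have ht₀T : t₀ < T := ht₀.2.trans_lt ht₂
  have ht₀0 : 0 < t₀ := ht₁.trans ht₀.1
  have hpeak : IsSpeedPeak u t₀ x₀ := fun y => (hmax y).trans heq.ge
  have hL' := hasDerivWithinAt_movingLevel (K := K) (δc := δc) ht₀.1 ht₀T
  have hpast' : ∀ t ∈ Ico 0 t₀, ‖u t x₀‖ ≤ movingLevel K δc T t₁ t := fun t ht => (hpast t ht x₀).le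
  have hhit := HittingCalculus.hitting_inequality_drift hsolc hν.le ⟨ht₀0, ht₀.2⟩
    (fun x => (hmax x).trans heq.ge) hL' hpast' heq
  have hgain := HittingCalculus.inner_timeDeriv_ge_of_past_le hsolc ⟨ht₀0, ht₀.2⟩ hL' hpast' heq
  have hzero : ⟪u t₀ x₀, (0 : ℝ → E3 → E3) t₀ x₀⟫ = 0 := by simp
  have hconv : timeDerivWithin (Icc 0 t₂) u t₀ x₀ = timeDerivWithin (Ico 0 T) u t₀ x₀ :=
    hsol.smooth_velocity.timeDerivWithin_eq_of_subset (Icc_subset_Ico_right ht₂)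
      (uniqueDiffOn_Icc ht₂0) ⟨ht₀0.le, ht₀.2⟩ x₀
  rw [hzero, ← heq] at hhit
  rw [hconv, ← heq] at hgain
  exact ⟨t₀, ht₀, x₀, hpeak, heq, hhit, hgain⟩


end Summit.NavierStokesRegularity.NavierStokesRegularity.Theorems.ScenarioCensus.PeakPush

end
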